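import Summits.QuantumFields.YangMills.Theorems.BalabanUVNodesN11Sect3SupplyChainBorelBObligations

/-!
# DAG node N11 — BOREL 𝐁-TERMS ALONG THE WITNESS CHAIN, III: N11's PRINTED OUTPUT `B16.Thm1Printed` AT THE CoPH DATUM of a Gaussian-class parameter ∕ of the NAMED certificate
# `gaussPinH θ` ∕ of (the certificate of) any H-extension of the witness of record — FROM A SUPPLIER PER WINDOWED RUN with `SupplierObligations` + `SupplierBorel` and the
# reading-line primitives in the window; the step windows are READ OFF the datum's flow (`flow.g = gOfRecord₁₃`, `rfl`), the printed `∃ γ` witnessed by `min γ θ.γ`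

HEADER — WORK-UNIT METADATA.  Cell `pub-ymgap`, YM-PLAN Track A (D-0062 ∕ D-0149 width seats), seat `pub-ymgap-dag-n11-w1` (g0; WIDTH SEAT 1 of 4 on NODE n11 [B14]),
route `BalabanUVNodes` rev 25, item K1⁷ `StabilityBAtRecordR13SepCoPH` = stmt-QuantumFields-20542 (helper, `--kind proof --supports 20542 --as helper`, count-neutral).
[III] = [Balaban1988Convergent], [B16] = [Balaban1989LargeFieldII].  Over this seat's `…N11Sect3SupplyChainBorelBObligations` (W1-X1 (iii)∕(iv): `NoExpansionObligation` at a Gaussian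
certificate from `SupplierBorel` + primitives) and dag-n11-e's `…N11Sect3SupplyChainNode.thm1Printed_datumOfRecord₁₃CoPH_of_obligations` (Theorem 1 printed from a supplier per
windowed run; NO `T`-family needed — def-T's `thm1Printed_datumOfRecord₁₃CoPH_of_tLaw_rOpLeaf` with the 𝐑-leaf closed on the live line).

WHAT THIS FILE PROVES (7 theorems, 0 `sorry`, 0 `def`; nothing of Bałaban asserted).
§1 ★ `step_inInterval_of_flow_inInterval_min`: a run in the datum's window `]0, min γ Γ]` is a run in `]0, γ]` with every prefix `k < K` in B12's step window `]0, Γ]` (READ OFF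
   the datum: `flow.g = gOfRecord₁₃` is `rfl`) — with `Γ := θ.γ` the `hw` row of dag-n11-d's door faces; `B16.Thm1Printed`'s `∃ γ` is then witnessed by `min γ θ.γ`
   (`0 < θ.γ` and `1 ≤ M` are READ OFF admissibility: `hθ.toStage9.gamma_pos`, `hθ.toStage9.2.2.2`), so NO `γ ≤ θ.γ` and NO `1 ≤ M` hypothesis is displayed.
§2 ★★★★ `thm1Printed_datumOfRecord₁₃CoPH_of_gaussCert_of_supplierBorel_of_bgReadCharged`: `B16.Thm1Printed (datumOfRecord₁₃CoPH F N θ h).C` at any Gaussian-class `θ` on the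
   live-selector line from, PER RUN IN ANY WINDOW `]0, γ]` (`0 < γ`): 12a″'s `RegOn` (parents + children), def-R's `BgProvisoΛ` over the charged reading supports (levels
   `k`, `k+1`), and [III] §3's supplier with `SupplierObligations` + `SupplierBorel` — no operand row, no term bound, no (K0b) row, no residual row, no `T`-family;
   ★★★★ `thm1Printed_datumOfRecord₁₃CoPH_gaussPinH_of_supplierBorel_of_bgReadCharged`: the same at the NAMED certificate `gaussPinH θ` — NO class hypothesis.
§3 ★★★★ `thm1Printed_datumOfRecord₁₃CoPH_gaussCertH_theta13LiveOfRecord_of_supplierBorel_of_bgReadCharged` (class form) ∕ ★★★★★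
   `thm1Printed_datumOfRecord₁₃CoPH_gaussPinH_theta13LiveOfRecordH_of_supplierBorel_of_bgReadCharged` (named form): N11's PRINTED OUTPUT at (the Gaussian certificate of) any
   H-extension `⟨⟨θ₁₃, Zr⟩, Zh, Phih⟩` of the witness of record with selector (`rfl`), admissibility and signs DISCHARGED — displayed EXACTLY: `hrec`, and for SOME `γ > 0`, per
   run in the window `]0, γ]`, the reading-line primitives and the supplier's obligations + Borel-ness.  THE HONEST STATE OF N11 ON THE `SupplierBorel` ROAD.
§4 ★★★★ `thm1Printed_datumOfRecord₁₃SepCoPH_of_gaussCert_of_supplierBorel_of_bgReadCharged` ∕ ★★★★★ `thm1Printed_datumOfRecord₁₃SepCoPH_gaussPinH_theta13LiveOfRecordH_of_supplierBorel_…`: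
   the K1⁷-KEYED editions at the v1.7 separated-range datum `datumOfRecord₁₃SepCoPH` (`= datumOfRecord₁₃CoPH … h.toCore`, def-T's `datumOfRecord₁₃SepCoPH_eq_coPH`, `rfl`).

HONEST FRAMING.  Helper lane of K1⁷; kernel bookkeeping; nothing of Bałaban asserted.  N11 NOT discharged (the displayed rows ARE [III] §3 + 12a″ + def-R's background
proviso); K1⁷ NOT closed; counts unmoved (typed 28∕28 · discharged 5∕27).  R4 closes only the conditional finite-𝕋⁴ rung `BalabanLadder.UV` of one programme at fixed
`ε = L^{−K}` — NOT ℝ⁴, NOT OS, NOT a mass gap, NOT Clay.  No `sorry`, `axiom`, `instance`, `notation`.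
Sources (SHAPE only): [III] Thm 1 p.262, Theorem p.245, §3 p.279, (3.24)–(3.25) p.270; [B16] Thm 1 p.355; [Balaban1987RG1] Thm 1 p.259 (the window `]0, γ]`).
-/

noncomputable section

open MeasureTheory
open scoped BigOperators ENNReal NNReal Matrix.Norms.L2Operator

namespace Summit.QuantumFields.YangMills.Theorems.BalabanUVNodesN11Sect3SupplyChainBorelBThm1Printed

open Literature.MathematicalPhysics.QuantumFieldTheory.Balaban1983to89 T4Continuum Node00 Node00.Tk
open B15DeterminingSets B8Eq17ClassAkV1 Step
open B10Eq42TorusConstraint (bondsIn)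
open BalabanUVNodesN11HistoryPinnedResidualDefs (ZhPinOfRecord₁₃)
open BalabanUVNodesN11Sect3SupplyChainDefs
open BalabanUVNodesN11Sect3SupplyChainBorelB (SupplierBorel)
open BalabanUVNodesN11Sect3SupplyChainObligationsDefs
open BalabanUVNodesN11Sect3SupplyChainNode (thm1Printed_datumOfRecord₁₃CoPH_of_obligations)
open BalabanUVNodesN11Sect3SupplyChainBorelBObligations
open BalabanUVNodesN11GaussianCertificateDefs (gaussPinH gaussPinH_ζ0 gaussPinH_quad provisos₁₃CoPH_gaussPinH)
open Literature.MathematicalPhysics.QuantumFieldTheory.Balaban1983to89.B16RLeafRecord13AtLive (kappa_nonneg_theta13LiveOfFamily B0_nonneg_theta13LiveOfFamily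
  E0_nonneg_theta13LiveOfFamily)

variable {F : T4Family} {N : ℕ} [NeZero N]

/-! ## §1  The step windows read off the datum's flow -/

section Window

variable (θ : Stage13HParams F N)

/-- **★ A RUN IN THE WINDOW `]0, min γ Γ]` IS A RUN IN THE WINDOW `]0, γ]` WITH EVERY PREFIX `k < K` IN B12's STEP WINDOW `]0, Γ]`** — read off the datum (`flow.g` is
`gOfRecord₁₃` by `flow_g_datumOfRecord₁₃CoPH`, `rfl`; cf. `Step.inInterval_iff`, `B14Cor3.inInterval_of_le`).  With `Γ := θ.γ` the second conjunct is the `hw` row of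
dag-n11-d's door faces. [cite: Balaban1987RG1, Thm 1 p.259; Balaban1988Convergent, (2.10) p.256 (bookkeeping)] -/
theorem step_inInterval_of_flow_inInterval_min (h : θ.Provisos₁₃CoPH F N) {γ Γ : ℝ} {P : B12.RunParams}
    (hP : ((datumOfRecord₁₃CoPH F N θ h).C P).flow.InInterval (min γ Γ) P.K) :
    Step.InInterval γ P.K (gOfRecord₁₃ F N θ.toStage13Params P) ∧ ∀ k, k < P.K → Step.InInterval Γ k (gOfRecord₁₃ F N θ.toStage13Params P) :=
  ⟨fun j hj => ⟨(hP j hj).1, (hP j hj).2.trans (min_le_left _ _)⟩,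
    fun _k hk j hj => ⟨(hP j (hj.trans hk.le)).1, (hP j (hj.trans hk.le)).2.trans (min_le_right _ _)⟩⟩

end Window

/-! ## §2  `B16.Thm1Printed` at the CoPH datum of a Gaussian-class `θ` ∕ of the named certificate `gaussPinH θ` from a supplier per windowed run -/

section Generic

variable (θ : Stage13HParams F N)

/-- **★★★★ N11's PRINTED OUTPUT `B16.Thm1Printed (datumOfRecord₁₃CoPH F N θ h).C` AT ANY GAUSSIAN-CLASS `θ` ON THE LIVE-SELECTOR LINE, FROM — PER RUN IN ANY WINDOW `]0, γ]`,
`0 < γ` — 12a″'s `RegOn` (parents + children), def-R's `BgProvisoΛ` OVER THE CHARGED READING SUPPORTS (levels `k`, `k+1`) AND [III] §3's SUPPLIER WITH `SupplierObligations`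
+ `SupplierBorel`**: dag-n11-e's `thm1Printed_datumOfRecord₁₃CoPH_of_obligations` with its `NoExpansionObligation` DISCHARGED run by run by
`…BorelBObligations.noExpansionObligation_of_gaussCert_of_supplierBorel_of_bgReadCharged`, the step windows read off the datum (§1) in the printed window `]0, min γ θ.γ]`
(`0 < θ.γ`, `1 ≤ M` from admissibility).  No operand row, no term bound, no (K0b) row, no residual row, no `T`-family, no `γ ≤ θ.γ`, no `1 ≤ M`. [cite: Balaban1988Convergent, Thm 1 p.262, Theorem p.245, §3 p.279, (3.24)–(3.25) p.270; Balaban1989LargeFieldII, Thm 1 p.355; Balaban1989LargeFieldI, (0.3)–(0.4) p.176, p.177 (i)–(ii)] -/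
theorem thm1Printed_datumOfRecord₁₃CoPH_of_gaussCert_of_supplierBorel_of_bgReadCharged
    (hζ : ∀ (p : B12.RunParams) (n : ℕ) (Ω Λ : ℕ → Set (Site (F.P p.K) 0)), (θ.Zh p n Ω Λ).ζ0 = (ZhPinOfRecord₁₃ θ.toStage13Params p Ω Λ).ζ0)
    (hq : ∀ (p : B12.RunParams) (n : ℕ) (Ω Λ : ℕ → Set (Site (F.P p.K) 0)) (j : ℕ) (Λ' : Set (Site (F.P p.K) 0)) (ω : MultiCfg (F.P p.K) (SU N) (FluctV N)),
      (θ.Zh p n Ω Λ).quad j Λ' ω = ∑ b ∈ (Set.toFinite (bondsIn j (Λ'ᶜ ∩ Ω (j + 1)))).toFinset, ‖(ω j).2 b‖ ^ 2)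
    (h : θ.Provisos₁₃CoPH F N) (hsel : θ.ppSel = ppSelLiveOfRecord F N θ.ν θ.τ9 (EOfRecord₁₃ F N θ.toStage13Params) (wOfRecord₉ F N θ.toStage9Params))
    (hθ : θ.Admissible F N) (hκ : 0 ≤ θ.s2.lf.κ) (hE₀ : 0 ≤ θ.s2.lf.E₀) (hB₀ : 0 ≤ θ.s2.lf.B₀) {γ : ℝ} (hγ : 0 < γ)
    (cR : B12.RunParams → ℝ)
    (Γr : (P : B12.RunParams) → (n : ℕ) → SeqOfRecord F θ.ν θ.τ9.M (gOfRecord₁₃ F N θ.toStage13Params P) P.K n → ℕ → Set (Site (F.P P.K) 0) → Set (Site (F.P P.K) 0))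
    (hreg : ∀ P : B12.RunParams, Step.InInterval γ P.K (gOfRecord₁₃ F N θ.toStage13Params P) →
      ∀ (n : ℕ) (s₀ : SeqOfRecord F θ.ν θ.τ9.M (gOfRecord₁₃ F N θ.toStage13Params P) P.K n),
        (θ.zhAt P s₀).RegOn F N (FluctV N) θ.ν (cR P) P (gOfRecord₁₃ F N θ.toStage13Params P) (Γr P n s₀))
    (hbg : ∀ P : B12.RunParams, Step.InInterval γ P.K (gOfRecord₁₃ F N θ.toStage13Params P) → ∀ k, k < P.K →
      BgProvisoΛ F N P.K (settingOfRecord₁₃ F N θ.toStage13Params P) (θ.Rz P.K) θ.τ9.M k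
        (fun s₀ => {Wc | slotsOfRecord F N θ.ν θ.τ9 (EOfRecord₁₃ F N θ.toStage13Params) (wOfRecord₉ F N θ.toStage9Params) θ.ppSel P
            (gOfRecord₁₃ F N θ.toStage13Params P) k s₀ ≠ 0 ∧
          chiSeqOfRecord F N θ.ν θ.τ9.M (gOfRecord₁₃ F N θ.toStage13Params P) P.K k s₀ (Wc k) ≠ 0 ∧
          ∀ j, j < k → PlaqSmallOn (plaqsOf (pts j (Γr P k s₀ j (s₀.Ω (j + 1))ᶜ))) (cR P * epsOfRecord θ.ν (gOfRecord₁₃ F N θ.toStage13Params P) j) (Wc j)})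
        (UbgOfRecord₁₃CoP F N θ.toStage13Params P k))
    (hbg' : ∀ P : B12.RunParams, Step.InInterval γ P.K (gOfRecord₁₃ F N θ.toStage13Params P) → ∀ k, k < P.K →
      BgProvisoΛ F N P.K (settingOfRecord₁₃ F N θ.toStage13Params P) (θ.Rz P.K) θ.τ9.M k
        (fun s : SeqOfRecord F θ.ν θ.τ9.M (gOfRecord₁₃ F N θ.toStage13Params P) P.K (k + 1) =>
          {Wc | slotsTOfRecord F N θ.ν θ.τ9 (EOfRecord₁₃ F N θ.toStage13Params) (wOfRecord₉ F N θ.toStage9Params) θ.ppSel P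
              (gOfRecord₁₃ F N θ.toStage13Params P) (k + 1) s ≠ 0 ∧
            chiSeqOfRecord F N θ.ν θ.τ9.M (gOfRecord₁₃ F N θ.toStage13Params P) P.K (k + 1) s (Wc (k + 1)) ≠ 0 ∧
            ∀ j, j < k + 1 → PlaqSmallOn (plaqsOf (pts j (Γr P (k + 1) s j (s.Ω (j + 1))ᶜ))) (cR P * epsOfRecord θ.ν (gOfRecord₁₃ F N θ.toStage13Params P) j) (Wc j)})
        (UbgOfRecord₁₃CoP F N θ.toStage13Params P (k + 1)))
    (σ : (P : B12.RunParams) → Sect3Supplier θ P) (hσ : ∀ P : B12.RunParams, Step.InInterval γ P.K (gOfRecord₁₃ F N θ.toStage13Params P) → SupplierObligations θ P (σ P))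
    (hσB : ∀ P : B12.RunParams, Step.InInterval γ P.K (gOfRecord₁₃ F N θ.toStage13Params P) → SupplierBorel θ P (σ P)) :
    B16.Thm1Printed (datumOfRecord₁₃CoPH F N θ h).C :=
  thm1Printed_datumOfRecord₁₃CoPH_of_obligations h hsel hθ hκ hE₀ hB₀ hθ.toStage9.2.2.2 (lt_min hγ hθ.toStage9.gamma_pos) σ
    (fun P hP => hσ P (step_inInterval_of_flow_inInterval_min θ h hP).1) fun P hP =>
    noExpansionObligation_of_gaussCert_of_supplierBorel_of_bgReadCharged θ P hζ hq h hθ hθ.toStage9.2.2.2 (step_inInterval_of_flow_inInterval_min θ h hP).2 (cR P)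
      (Γr P) (hreg P (step_inInterval_of_flow_inInterval_min θ h hP).1) (hbg P (step_inInterval_of_flow_inInterval_min θ h hP).1)
      (hbg' P (step_inInterval_of_flow_inInterval_min θ h hP).1) (σ P) (hσB P (step_inInterval_of_flow_inInterval_min θ h hP).1)

/-- **★★★★ N11's PRINTED OUTPUT AT THE CoPH DATUM OF THE NAMED GAUSSIAN CERTIFICATE `gaussPinH θ` — NO CLASS HYPOTHESIS** (the previous theorem at `gaussPinH θ`: `gaussPinH_ζ0` ∕
`gaussPinH_quad` are `rfl`, the core provisos transfer by `provisos₁₃CoPH_gaussPinH`; hypotheses in `θ`'s vocabulary, 12a″'s `RegOn` read at the certificate's `zhAt`).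
[cite: Balaban1988Convergent, Thm 1 p.262, Theorem p.245, §3 p.279, (3.24)–(3.25) p.270; Balaban1989LargeFieldII, Thm 1 p.355; Balaban1989LargeFieldI, (0.3)–(0.4) p.176] -/
theorem thm1Printed_datumOfRecord₁₃CoPH_gaussPinH_of_supplierBorel_of_bgReadCharged
    (h : θ.Provisos₁₃CoPH F N) (hsel : θ.ppSel = ppSelLiveOfRecord F N θ.ν θ.τ9 (EOfRecord₁₃ F N θ.toStage13Params) (wOfRecord₉ F N θ.toStage9Params))
    (hθ : θ.Admissible F N) (hκ : 0 ≤ θ.s2.lf.κ) (hE₀ : 0 ≤ θ.s2.lf.E₀) (hB₀ : 0 ≤ θ.s2.lf.B₀) {γ : ℝ} (hγ : 0 < γ)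
    (cR : B12.RunParams → ℝ)
    (Γr : (P : B12.RunParams) → (n : ℕ) → SeqOfRecord F θ.ν θ.τ9.M (gOfRecord₁₃ F N θ.toStage13Params P) P.K n → ℕ → Set (Site (F.P P.K) 0) → Set (Site (F.P P.K) 0))
    (hreg : ∀ P : B12.RunParams, Step.InInterval γ P.K (gOfRecord₁₃ F N θ.toStage13Params P) →
      ∀ (n : ℕ) (s₀ : SeqOfRecord F θ.ν θ.τ9.M (gOfRecord₁₃ F N θ.toStage13Params P) P.K n),
        ((gaussPinH θ).zhAt P s₀).RegOn F N (FluctV N) θ.ν (cR P) P (gOfRecord₁₃ F N θ.toStage13Params P) (Γr P n s₀))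
    (hbg : ∀ P : B12.RunParams, Step.InInterval γ P.K (gOfRecord₁₃ F N θ.toStage13Params P) → ∀ k, k < P.K →
      BgProvisoΛ F N P.K (settingOfRecord₁₃ F N θ.toStage13Params P) (θ.Rz P.K) θ.τ9.M k
        (fun s₀ => {Wc | slotsOfRecord F N θ.ν θ.τ9 (EOfRecord₁₃ F N θ.toStage13Params) (wOfRecord₉ F N θ.toStage9Params) θ.ppSel P
            (gOfRecord₁₃ F N θ.toStage13Params P) k s₀ ≠ 0 ∧
          chiSeqOfRecord F N θ.ν θ.τ9.M (gOfRecord₁₃ F N θ.toStage13Params P) P.K k s₀ (Wc k) ≠ 0 ∧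
          ∀ j, j < k → PlaqSmallOn (plaqsOf (pts j (Γr P k s₀ j (s₀.Ω (j + 1))ᶜ))) (cR P * epsOfRecord θ.ν (gOfRecord₁₃ F N θ.toStage13Params P) j) (Wc j)})
        (UbgOfRecord₁₃CoP F N θ.toStage13Params P k))
    (hbg' : ∀ P : B12.RunParams, Step.InInterval γ P.K (gOfRecord₁₃ F N θ.toStage13Params P) → ∀ k, k < P.K →
      BgProvisoΛ F N P.K (settingOfRecord₁₃ F N θ.toStage13Params P) (θ.Rz P.K) θ.τ9.M k
        (fun s : SeqOfRecord F θ.ν θ.τ9.M (gOfRecord₁₃ F N θ.toStage13Params P) P.K (k + 1) =>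
          {Wc | slotsTOfRecord F N θ.ν θ.τ9 (EOfRecord₁₃ F N θ.toStage13Params) (wOfRecord₉ F N θ.toStage9Params) θ.ppSel P
              (gOfRecord₁₃ F N θ.toStage13Params P) (k + 1) s ≠ 0 ∧
            chiSeqOfRecord F N θ.ν θ.τ9.M (gOfRecord₁₃ F N θ.toStage13Params P) P.K (k + 1) s (Wc (k + 1)) ≠ 0 ∧
            ∀ j, j < k + 1 → PlaqSmallOn (plaqsOf (pts j (Γr P (k + 1) s j (s.Ω (j + 1))ᶜ))) (cR P * epsOfRecord θ.ν (gOfRecord₁₃ F N θ.toStage13Params P) j) (Wc j)})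
        (UbgOfRecord₁₃CoP F N θ.toStage13Params P (k + 1)))
    (σ : (P : B12.RunParams) → Sect3Supplier (gaussPinH θ) P) (hσ : ∀ P : B12.RunParams, Step.InInterval γ P.K (gOfRecord₁₃ F N θ.toStage13Params P) → SupplierObligations (gaussPinH θ) P (σ P))
    (hσB : ∀ P : B12.RunParams, Step.InInterval γ P.K (gOfRecord₁₃ F N θ.toStage13Params P) → SupplierBorel (gaussPinH θ) P (σ P)) :
    B16.Thm1Printed (datumOfRecord₁₃CoPH F N (gaussPinH θ) (provisos₁₃CoPH_gaussPinH h)).C :=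
  thm1Printed_datumOfRecord₁₃CoPH_of_gaussCert_of_supplierBorel_of_bgReadCharged (gaussPinH θ) (gaussPinH_ζ0 θ) (gaussPinH_quad θ) (provisos₁₃CoPH_gaussPinH h) hsel hθ
    hκ hE₀ hB₀ hγ cR Γr hreg hbg hbg' σ hσ hσB

end Generic

/-! ## §3  At (the Gaussian certificate of) any H-extension of the witness of record: selector, admissibility, signs and `M = 1` discharged -/

section Record

variable (F N)
variable {Zr : (q : B12.RunParams) → TkResidualW F N (FluctV N) q.K}
  {Zh : (q : B12.RunParams) → ℕ → (ℕ → Set (Site (F.P q.K) 0)) → (ℕ → Set (Site (F.P q.K) 0)) → TkResidualW F N (FluctV N) q.K}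
  {Phih : (q : B12.RunParams) → ℕ → (ℕ → Set (Site (F.P q.K) 0)) → (ℕ → Set (Site (F.P q.K) 0)) → (ℕ → Plaq (F.P q.K) 0 → ℝ)}

/-- **★★★★ N11's PRINTED OUTPUT `B16.Thm1Printed` AT THE CoPH DATUM OF ANY GAUSSIAN-CLASS H-EXTENSION `⟨⟨θ₁₃, Zr⟩, Zh, Phih⟩` OF THE WITNESS OF RECORD** (class form) — from `hrec`
and, for some `γ > 0`, per run in the window `]0, γ]`, the reading-line primitives and [III] §3's supplier with `SupplierObligations` + `SupplierBorel`; selector `rfl`,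
`admissible_theta13LiveOfRecord`, the family's signs discharged. [cite: Balaban1988Convergent, Thm 1 p.262, Theorem p.245, §3 p.279; Balaban1989LargeFieldII, Thm 1 p.355; Balaban1989LargeFieldI, (0.3)–(0.4) p.176, p.177 (i)–(ii)] -/
theorem thm1Printed_datumOfRecord₁₃CoPH_gaussCertH_theta13LiveOfRecord_of_supplierBorel_of_bgReadCharged
    (hζ : ∀ (p : B12.RunParams) (n : ℕ) (Ω Λ : ℕ → Set (Site (F.P p.K) 0)), (Zh p n Ω Λ).ζ0 = (ZhPinOfRecord₁₃ (theta13LiveOfRecord F N) p Ω Λ).ζ0)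
    (hq : ∀ (p : B12.RunParams) (n : ℕ) (Ω Λ : ℕ → Set (Site (F.P p.K) 0)) (j : ℕ) (Λ' : Set (Site (F.P p.K) 0)) (ω : MultiCfg (F.P p.K) (SU N) (FluctV N)),
      (Zh p n Ω Λ).quad j Λ' ω = ∑ b ∈ (Set.toFinite (bondsIn j (Λ'ᶜ ∩ Ω (j + 1)))).toFinset, ‖(ω j).2 b‖ ^ 2)
    (hrec : (⟨⟨theta13LiveOfRecord F N, Zr⟩, Zh, Phih⟩ : Stage13HParams F N).Provisos₁₃CoPH F N) {γ : ℝ} (hγ : 0 < γ)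
    (cR : B12.RunParams → ℝ)
    (Γr : (P : B12.RunParams) → (n : ℕ) → SeqOfRecord F (theta13LiveOfRecord F N).ν (theta13LiveOfRecord F N).τ9.M (gOfRecord₁₃ F N (theta13LiveOfRecord F N) P) P.K n → ℕ → Set (Site (F.P P.K) 0) → Set (Site (F.P P.K) 0))
    (hreg : ∀ P : B12.RunParams, Step.InInterval γ P.K (gOfRecord₁₃ F N (theta13LiveOfRecord F N) P) →
      ∀ (n : ℕ) (s₀ : SeqOfRecord F (theta13LiveOfRecord F N).ν (theta13LiveOfRecord F N).τ9.M (gOfRecord₁₃ F N (theta13LiveOfRecord F N) P) P.K n),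
        ((⟨⟨theta13LiveOfRecord F N, Zr⟩, Zh, Phih⟩ : Stage13HParams F N).zhAt P s₀).RegOn F N (FluctV N) (theta13LiveOfRecord F N).ν (cR P) P (gOfRecord₁₃ F N (theta13LiveOfRecord F N) P) (Γr P n s₀))
    (hbg : ∀ P : B12.RunParams, Step.InInterval γ P.K (gOfRecord₁₃ F N (theta13LiveOfRecord F N) P) → ∀ k, k < P.K →
      BgProvisoΛ F N P.K (settingOfRecord₁₃ F N (theta13LiveOfRecord F N) P) ((theta13LiveOfRecord F N).Rz P.K) (theta13LiveOfRecord F N).τ9.M k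
        (fun s₀ => {Wc | slotsOfRecord F N (theta13LiveOfRecord F N).ν (theta13LiveOfRecord F N).τ9 (EOfRecord₁₃ F N (theta13LiveOfRecord F N)) (wOfRecord₉ F N (theta13LiveOfRecord F N).toStage9Params) (theta13LiveOfRecord F N).ppSel P
            (gOfRecord₁₃ F N (theta13LiveOfRecord F N) P) k s₀ ≠ 0 ∧
          chiSeqOfRecord F N (theta13LiveOfRecord F N).ν (theta13LiveOfRecord F N).τ9.M (gOfRecord₁₃ F N (theta13LiveOfRecord F N) P) P.K k s₀ (Wc k) ≠ 0 ∧
          ∀ j, j < k → PlaqSmallOn (plaqsOf (pts j (Γr P k s₀ j (s₀.Ω (j + 1))ᶜ))) (cR P * epsOfRecord (theta13LiveOfRecord F N).ν (gOfRecord₁₃ F N (theta13LiveOfRecord F N) P) j) (Wc j)})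
        (UbgOfRecord₁₃CoP F N (theta13LiveOfRecord F N) P k))
    (hbg' : ∀ P : B12.RunParams, Step.InInterval γ P.K (gOfRecord₁₃ F N (theta13LiveOfRecord F N) P) → ∀ k, k < P.K →
      BgProvisoΛ F N P.K (settingOfRecord₁₃ F N (theta13LiveOfRecord F N) P) ((theta13LiveOfRecord F N).Rz P.K) (theta13LiveOfRecord F N).τ9.M k
        (fun s : SeqOfRecord F (theta13LiveOfRecord F N).ν (theta13LiveOfRecord F N).τ9.M (gOfRecord₁₃ F N (theta13LiveOfRecord F N) P) P.K (k + 1) =>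
          {Wc | slotsTOfRecord F N (theta13LiveOfRecord F N).ν (theta13LiveOfRecord F N).τ9 (EOfRecord₁₃ F N (theta13LiveOfRecord F N)) (wOfRecord₉ F N (theta13LiveOfRecord F N).toStage9Params) (theta13LiveOfRecord F N).ppSel P
              (gOfRecord₁₃ F N (theta13LiveOfRecord F N) P) (k + 1) s ≠ 0 ∧
            chiSeqOfRecord F N (theta13LiveOfRecord F N).ν (theta13LiveOfRecord F N).τ9.M (gOfRecord₁₃ F N (theta13LiveOfRecord F N) P) P.K (k + 1) s (Wc (k + 1)) ≠ 0 ∧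
            ∀ j, j < k + 1 → PlaqSmallOn (plaqsOf (pts j (Γr P (k + 1) s j (s.Ω (j + 1))ᶜ))) (cR P * epsOfRecord (theta13LiveOfRecord F N).ν (gOfRecord₁₃ F N (theta13LiveOfRecord F N) P) j) (Wc j)})
        (UbgOfRecord₁₃CoP F N (theta13LiveOfRecord F N) P (k + 1)))
    (σ : (P : B12.RunParams) → Sect3Supplier (⟨⟨theta13LiveOfRecord F N, Zr⟩, Zh, Phih⟩ : Stage13HParams F N) P)
    (hσ : ∀ P : B12.RunParams, Step.InInterval γ P.K (gOfRecord₁₃ F N (theta13LiveOfRecord F N) P) → SupplierObligations (⟨⟨theta13LiveOfRecord F N, Zr⟩, Zh, Phih⟩ : Stage13HParams F N) P (σ P))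
    (hσB : ∀ P : B12.RunParams, Step.InInterval γ P.K (gOfRecord₁₃ F N (theta13LiveOfRecord F N) P) → SupplierBorel (⟨⟨theta13LiveOfRecord F N, Zr⟩, Zh, Phih⟩ : Stage13HParams F N) P (σ P)) :
    B16.Thm1Printed (datumOfRecord₁₃CoPH F N (⟨⟨theta13LiveOfRecord F N, Zr⟩, Zh, Phih⟩ : Stage13HParams F N) hrec).C :=
  thm1Printed_datumOfRecord₁₃CoPH_of_gaussCert_of_supplierBorel_of_bgReadCharged (⟨⟨theta13LiveOfRecord F N, Zr⟩, Zh, Phih⟩ : Stage13HParams F N) hζ hq hrec rfl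
    (admissible_theta13LiveOfRecord F N) (kappa_nonneg_theta13LiveOfFamily F N eps0OfRecord₁₃ (zeta316OfRecord F N (numerics7OfFamily eps0OfRecord₁₃) 1 1) (RzOfRecord F N) (ZtOfRecord F N))
    (E0_nonneg_theta13LiveOfFamily F N eps0OfRecord₁₃ (zeta316OfRecord F N (numerics7OfFamily eps0OfRecord₁₃) 1 1) (RzOfRecord F N) (ZtOfRecord F N)) (B0_nonneg_theta13LiveOfFamily F N eps0OfRecord₁₃ (zeta316OfRecord F N (numerics7OfFamily eps0OfRecord₁₃) 1 1) (RzOfRecord F N) (ZtOfRecord F N))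
    hγ cR Γr hreg hbg hbg' σ hσ hσB

/-- **★★★★★ N11's PRINTED OUTPUT `B16.Thm1Printed` AT THE CoPH DATUM OF THE NAMED GAUSSIAN CERTIFICATE `gaussPinH ⟨⟨θ₁₃, Zr⟩, Zh, Phih⟩` OF ANY H-EXTENSION OF THE WITNESS OF
RECORD — THE HONEST STATE OF N11 ON THE `SupplierBorel` ROAD.**  Displayed EXACTLY: the datum's key `hrec`; SOME `γ > 0`; and PER RUN IN THE WINDOW `]0, γ]` 12a″'s `RegOn` at
the certificate (parents + children), def-R's `BgProvisoΛ` over the charged reading supports (levels `k`, `k+1`), and [III] §3's supplier with `SupplierObligations` +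
`SupplierBorel`.  NO class hypothesis, NO operand row, NO term bound, NO (K0b) row, NO residual row, NO `T`-family, NO `γ ≤ θ.γ`; selector ∕ admissibility ∕ signs discharged.
[cite: Balaban1988Convergent, Thm 1 p.262, Theorem p.245, §3 p.279, (3.24)–(3.25) p.270; Balaban1989LargeFieldII, Thm 1 p.355; Balaban1989LargeFieldI, (0.3)–(0.4) p.176, p.177 (i)–(ii)] -/
theorem thm1Printed_datumOfRecord₁₃CoPH_gaussPinH_theta13LiveOfRecordH_of_supplierBorel_of_bgReadCharged
    (hrec : (⟨⟨theta13LiveOfRecord F N, Zr⟩, Zh, Phih⟩ : Stage13HParams F N).Provisos₁₃CoPH F N) {γ : ℝ} (hγ : 0 < γ)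
    (cR : B12.RunParams → ℝ)
    (Γr : (P : B12.RunParams) → (n : ℕ) → SeqOfRecord F (theta13LiveOfRecord F N).ν (theta13LiveOfRecord F N).τ9.M (gOfRecord₁₃ F N (theta13LiveOfRecord F N) P) P.K n → ℕ → Set (Site (F.P P.K) 0) → Set (Site (F.P P.K) 0))
    (hreg : ∀ P : B12.RunParams, Step.InInterval γ P.K (gOfRecord₁₃ F N (theta13LiveOfRecord F N) P) →
      ∀ (n : ℕ) (s₀ : SeqOfRecord F (theta13LiveOfRecord F N).ν (theta13LiveOfRecord F N).τ9.M (gOfRecord₁₃ F N (theta13LiveOfRecord F N) P) P.K n),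
        ((gaussPinH (⟨⟨theta13LiveOfRecord F N, Zr⟩, Zh, Phih⟩ : Stage13HParams F N)).zhAt P s₀).RegOn F N (FluctV N) (theta13LiveOfRecord F N).ν (cR P) P (gOfRecord₁₃ F N (theta13LiveOfRecord F N) P) (Γr P n s₀))
    (hbg : ∀ P : B12.RunParams, Step.InInterval γ P.K (gOfRecord₁₃ F N (theta13LiveOfRecord F N) P) → ∀ k, k < P.K →
      BgProvisoΛ F N P.K (settingOfRecord₁₃ F N (theta13LiveOfRecord F N) P) ((theta13LiveOfRecord F N).Rz P.K) (theta13LiveOfRecord F N).τ9.M k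
        (fun s₀ => {Wc | slotsOfRecord F N (theta13LiveOfRecord F N).ν (theta13LiveOfRecord F N).τ9 (EOfRecord₁₃ F N (theta13LiveOfRecord F N)) (wOfRecord₉ F N (theta13LiveOfRecord F N).toStage9Params) (theta13LiveOfRecord F N).ppSel P
            (gOfRecord₁₃ F N (theta13LiveOfRecord F N) P) k s₀ ≠ 0 ∧
          chiSeqOfRecord F N (theta13LiveOfRecord F N).ν (theta13LiveOfRecord F N).τ9.M (gOfRecord₁₃ F N (theta13LiveOfRecord F N) P) P.K k s₀ (Wc k) ≠ 0 ∧
          ∀ j, j < k → PlaqSmallOn (plaqsOf (pts j (Γr P k s₀ j (s₀.Ω (j + 1))ᶜ))) (cR P * epsOfRecord (theta13LiveOfRecord F N).ν (gOfRecord₁₃ F N (theta13LiveOfRecord F N) P) j) (Wc j)})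
        (UbgOfRecord₁₃CoP F N (theta13LiveOfRecord F N) P k))
    (hbg' : ∀ P : B12.RunParams, Step.InInterval γ P.K (gOfRecord₁₃ F N (theta13LiveOfRecord F N) P) → ∀ k, k < P.K →
      BgProvisoΛ F N P.K (settingOfRecord₁₃ F N (theta13LiveOfRecord F N) P) ((theta13LiveOfRecord F N).Rz P.K) (theta13LiveOfRecord F N).τ9.M k
        (fun s : SeqOfRecord F (theta13LiveOfRecord F N).ν (theta13LiveOfRecord F N).τ9.M (gOfRecord₁₃ F N (theta13LiveOfRecord F N) P) P.K (k + 1) =>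
          {Wc | slotsTOfRecord F N (theta13LiveOfRecord F N).ν (theta13LiveOfRecord F N).τ9 (EOfRecord₁₃ F N (theta13LiveOfRecord F N)) (wOfRecord₉ F N (theta13LiveOfRecord F N).toStage9Params) (theta13LiveOfRecord F N).ppSel P
              (gOfRecord₁₃ F N (theta13LiveOfRecord F N) P) (k + 1) s ≠ 0 ∧
            chiSeqOfRecord F N (theta13LiveOfRecord F N).ν (theta13LiveOfRecord F N).τ9.M (gOfRecord₁₃ F N (theta13LiveOfRecord F N) P) P.K (k + 1) s (Wc (k + 1)) ≠ 0 ∧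
            ∀ j, j < k + 1 → PlaqSmallOn (plaqsOf (pts j (Γr P (k + 1) s j (s.Ω (j + 1))ᶜ))) (cR P * epsOfRecord (theta13LiveOfRecord F N).ν (gOfRecord₁₃ F N (theta13LiveOfRecord F N) P) j) (Wc j)})
        (UbgOfRecord₁₃CoP F N (theta13LiveOfRecord F N) P (k + 1)))
    (σ : (P : B12.RunParams) → Sect3Supplier (gaussPinH (⟨⟨theta13LiveOfRecord F N, Zr⟩, Zh, Phih⟩ : Stage13HParams F N)) P)
    (hσ : ∀ P : B12.RunParams, Step.InInterval γ P.K (gOfRecord₁₃ F N (theta13LiveOfRecord F N) P) → SupplierObligations (gaussPinH (⟨⟨theta13LiveOfRecord F N, Zr⟩, Zh, Phih⟩ : Stage13HParams F N)) P (σ P))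
    (hσB : ∀ P : B12.RunParams, Step.InInterval γ P.K (gOfRecord₁₃ F N (theta13LiveOfRecord F N) P) → SupplierBorel (gaussPinH (⟨⟨theta13LiveOfRecord F N, Zr⟩, Zh, Phih⟩ : Stage13HParams F N)) P (σ P)) :
    B16.Thm1Printed (datumOfRecord₁₃CoPH F N (gaussPinH (⟨⟨theta13LiveOfRecord F N, Zr⟩, Zh, Phih⟩ : Stage13HParams F N)) (provisos₁₃CoPH_gaussPinH hrec)).C :=
  thm1Printed_datumOfRecord₁₃CoPH_gaussPinH_of_supplierBorel_of_bgReadCharged (⟨⟨theta13LiveOfRecord F N, Zr⟩, Zh, Phih⟩ : Stage13HParams F N) hrec rfl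
    (admissible_theta13LiveOfRecord F N) (kappa_nonneg_theta13LiveOfFamily F N eps0OfRecord₁₃ (zeta316OfRecord F N (numerics7OfFamily eps0OfRecord₁₃) 1 1) (RzOfRecord F N) (ZtOfRecord F N))
    (E0_nonneg_theta13LiveOfFamily F N eps0OfRecord₁₃ (zeta316OfRecord F N (numerics7OfFamily eps0OfRecord₁₃) 1 1) (RzOfRecord F N) (ZtOfRecord F N)) (B0_nonneg_theta13LiveOfFamily F N eps0OfRecord₁₃ (zeta316OfRecord F N (numerics7OfFamily eps0OfRecord₁₃) 1 1) (RzOfRecord F N) (ZtOfRecord F N))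
    hγ cR Γr hreg hbg hbg' σ hσ hσB

end Record

/-! ## §4  K1⁷-KEYED editions: the same at the v1.7 SEPARATED-RANGE datum `datumOfRecord₁₃SepCoPH` (`= datumOfRecord₁₃CoPH … h.toCore`, `rfl`) -/

section KKeyed

variable (θ : Stage13HParams F N)

/-- **★★★★ N11's PRINTED OUTPUT AT THE K1⁷-KEYED DATUM `datumOfRecord₁₃SepCoPH F N θ h` OF A GAUSSIAN-CLASS `θ`** (K1⁷'s `∃`-body reads `(h : θ.Provisos₁₃SepCoPH F 2)` and the
datum `datumOfRecord₁₃SepCoPH F 2 θ h`): §2 at `h.toCore` through def-T's `datumOfRecord₁₃SepCoPH_eq_coPH` (`rfl`).  Same displayed rows; nothing else.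
[cite: Balaban1988Convergent, Thm 1 p.262, Theorem p.245, §3 p.279, (0.2) p.244; Balaban1989LargeFieldII, Thm 1 p.355; Balaban1989LargeFieldI, (0.3)–(0.4) p.176] -/
theorem thm1Printed_datumOfRecord₁₃SepCoPH_of_gaussCert_of_supplierBorel_of_bgReadCharged
    (hζ : ∀ (p : B12.RunParams) (n : ℕ) (Ω Λ : ℕ → Set (Site (F.P p.K) 0)), (θ.Zh p n Ω Λ).ζ0 = (ZhPinOfRecord₁₃ θ.toStage13Params p Ω Λ).ζ0)
    (hq : ∀ (p : B12.RunParams) (n : ℕ) (Ω Λ : ℕ → Set (Site (F.P p.K) 0)) (j : ℕ) (Λ' : Set (Site (F.P p.K) 0)) (ω : MultiCfg (F.P p.K) (SU N) (FluctV N)),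
      (θ.Zh p n Ω Λ).quad j Λ' ω = ∑ b ∈ (Set.toFinite (bondsIn j (Λ'ᶜ ∩ Ω (j + 1)))).toFinset, ‖(ω j).2 b‖ ^ 2)
    (h : θ.Provisos₁₃SepCoPH F N) (hsel : θ.ppSel = ppSelLiveOfRecord F N θ.ν θ.τ9 (EOfRecord₁₃ F N θ.toStage13Params) (wOfRecord₉ F N θ.toStage9Params))
    (hθ : θ.Admissible F N) (hκ : 0 ≤ θ.s2.lf.κ) (hE₀ : 0 ≤ θ.s2.lf.E₀) (hB₀ : 0 ≤ θ.s2.lf.B₀) {γ : ℝ} (hγ : 0 < γ)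
    (cR : B12.RunParams → ℝ)
    (Γr : (P : B12.RunParams) → (n : ℕ) → SeqOfRecord F θ.ν θ.τ9.M (gOfRecord₁₃ F N θ.toStage13Params P) P.K n → ℕ → Set (Site (F.P P.K) 0) → Set (Site (F.P P.K) 0))
    (hreg : ∀ P : B12.RunParams, Step.InInterval γ P.K (gOfRecord₁₃ F N θ.toStage13Params P) →
      ∀ (n : ℕ) (s₀ : SeqOfRecord F θ.ν θ.τ9.M (gOfRecord₁₃ F N θ.toStage13Params P) P.K n),
        (θ.zhAt P s₀).RegOn F N (FluctV N) θ.ν (cR P) P (gOfRecord₁₃ F N θ.toStage13Params P) (Γr P n s₀))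
    (hbg : ∀ P : B12.RunParams, Step.InInterval γ P.K (gOfRecord₁₃ F N θ.toStage13Params P) → ∀ k, k < P.K →
      BgProvisoΛ F N P.K (settingOfRecord₁₃ F N θ.toStage13Params P) (θ.Rz P.K) θ.τ9.M k
        (fun s₀ => {Wc | slotsOfRecord F N θ.ν θ.τ9 (EOfRecord₁₃ F N θ.toStage13Params) (wOfRecord₉ F N θ.toStage9Params) θ.ppSel P
            (gOfRecord₁₃ F N θ.toStage13Params P) k s₀ ≠ 0 ∧
          chiSeqOfRecord F N θ.ν θ.τ9.M (gOfRecord₁₃ F N θ.toStage13Params P) P.K k s₀ (Wc k) ≠ 0 ∧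
          ∀ j, j < k → PlaqSmallOn (plaqsOf (pts j (Γr P k s₀ j (s₀.Ω (j + 1))ᶜ))) (cR P * epsOfRecord θ.ν (gOfRecord₁₃ F N θ.toStage13Params P) j) (Wc j)})
        (UbgOfRecord₁₃CoP F N θ.toStage13Params P k))
    (hbg' : ∀ P : B12.RunParams, Step.InInterval γ P.K (gOfRecord₁₃ F N θ.toStage13Params P) → ∀ k, k < P.K →
      BgProvisoΛ F N P.K (settingOfRecord₁₃ F N θ.toStage13Params P) (θ.Rz P.K) θ.τ9.M k
        (fun s : SeqOfRecord F θ.ν θ.τ9.M (gOfRecord₁₃ F N θ.toStage13Params P) P.K (k + 1) =>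
          {Wc | slotsTOfRecord F N θ.ν θ.τ9 (EOfRecord₁₃ F N θ.toStage13Params) (wOfRecord₉ F N θ.toStage9Params) θ.ppSel P
              (gOfRecord₁₃ F N θ.toStage13Params P) (k + 1) s ≠ 0 ∧
            chiSeqOfRecord F N θ.ν θ.τ9.M (gOfRecord₁₃ F N θ.toStage13Params P) P.K (k + 1) s (Wc (k + 1)) ≠ 0 ∧
            ∀ j, j < k + 1 → PlaqSmallOn (plaqsOf (pts j (Γr P (k + 1) s j (s.Ω (j + 1))ᶜ))) (cR P * epsOfRecord θ.ν (gOfRecord₁₃ F N θ.toStage13Params P) j) (Wc j)})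
        (UbgOfRecord₁₃CoP F N θ.toStage13Params P (k + 1)))
    (σ : (P : B12.RunParams) → Sect3Supplier θ P) (hσ : ∀ P : B12.RunParams, Step.InInterval γ P.K (gOfRecord₁₃ F N θ.toStage13Params P) → SupplierObligations θ P (σ P))
    (hσB : ∀ P : B12.RunParams, Step.InInterval γ P.K (gOfRecord₁₃ F N θ.toStage13Params P) → SupplierBorel θ P (σ P)) :
    B16.Thm1Printed (datumOfRecord₁₃SepCoPH F N θ h).C :=
  thm1Printed_datumOfRecord₁₃CoPH_of_gaussCert_of_supplierBorel_of_bgReadCharged θ hζ hq h.toCore hsel hθ hκ hE₀ hB₀ hγ cR Γr hreg hbg hbg' σ hσ hσB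

end KKeyed

section KKeyedRecord

variable (F N)
variable {Zr : (q : B12.RunParams) → TkResidualW F N (FluctV N) q.K}
  {Zh : (q : B12.RunParams) → ℕ → (ℕ → Set (Site (F.P q.K) 0)) → (ℕ → Set (Site (F.P q.K) 0)) → TkResidualW F N (FluctV N) q.K}
  {Phih : (q : B12.RunParams) → ℕ → (ℕ → Set (Site (F.P q.K) 0)) → (ℕ → Set (Site (F.P q.K) 0)) → (ℕ → Plaq (F.P q.K) 0 → ℝ)}

/-- **★★★★★ N11's PRINTED OUTPUT AT THE K1⁷-KEYED DATUM OF THE NAMED GAUSSIAN CERTIFICATE `gaussPinH ⟨⟨θ₁₃, Zr⟩, Zh, Phih⟩` OF ANY H-EXTENSION OF THE WITNESS OF RECORD**, for ANY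
separated-range key `hG` of the certificate (the datum reads `hG` through `Prop` only; K1⁷'s `∃`-body supplies such an `hG`, e.g. `(antecedent_gaussPinH …).1`) — §3's named face
through `datumOfRecord₁₃SepCoPH_eq_coPH` (`rfl`).  Displayed EXACTLY: `hrec` (core key of the extension), `hG`, SOME `γ > 0`, and per run in `]0, γ]` the reading-line
primitives + [III] §3's supplier with `SupplierObligations` + `SupplierBorel`.  THE HONEST STATE OF N11 ON THE `SupplierBorel` ROAD, IN K1⁷'s KEY.
[cite: Balaban1988Convergent, Thm 1 p.262, Theorem p.245, §3 p.279, (0.2) p.244; Balaban1989LargeFieldII, Thm 1 p.355; Balaban1989LargeFieldI, (0.3)–(0.4) p.176, p.177 (i)–(ii)] -/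
theorem thm1Printed_datumOfRecord₁₃SepCoPH_gaussPinH_theta13LiveOfRecordH_of_supplierBorel_of_bgReadCharged
    (hrec : (⟨⟨theta13LiveOfRecord F N, Zr⟩, Zh, Phih⟩ : Stage13HParams F N).Provisos₁₃CoPH F N) (hG : (gaussPinH (⟨⟨theta13LiveOfRecord F N, Zr⟩, Zh, Phih⟩ : Stage13HParams F N)).Provisos₁₃SepCoPH F N) {γ : ℝ} (hγ : 0 < γ)
    (cR : B12.RunParams → ℝ)
    (Γr : (P : B12.RunParams) → (n : ℕ) → SeqOfRecord F (theta13LiveOfRecord F N).ν (theta13LiveOfRecord F N).τ9.M (gOfRecord₁₃ F N (theta13LiveOfRecord F N) P) P.K n → ℕ → Set (Site (F.P P.K) 0) → Set (Site (F.P P.K) 0))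
    (hreg : ∀ P : B12.RunParams, Step.InInterval γ P.K (gOfRecord₁₃ F N (theta13LiveOfRecord F N) P) →
      ∀ (n : ℕ) (s₀ : SeqOfRecord F (theta13LiveOfRecord F N).ν (theta13LiveOfRecord F N).τ9.M (gOfRecord₁₃ F N (theta13LiveOfRecord F N) P) P.K n),
        ((gaussPinH (⟨⟨theta13LiveOfRecord F N, Zr⟩, Zh, Phih⟩ : Stage13HParams F N)).zhAt P s₀).RegOn F N (FluctV N) (theta13LiveOfRecord F N).ν (cR P) P (gOfRecord₁₃ F N (theta13LiveOfRecord F N) P) (Γr P n s₀))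
    (hbg : ∀ P : B12.RunParams, Step.InInterval γ P.K (gOfRecord₁₃ F N (theta13LiveOfRecord F N) P) → ∀ k, k < P.K →
      BgProvisoΛ F N P.K (settingOfRecord₁₃ F N (theta13LiveOfRecord F N) P) ((theta13LiveOfRecord F N).Rz P.K) (theta13LiveOfRecord F N).τ9.M k
        (fun s₀ => {Wc | slotsOfRecord F N (theta13LiveOfRecord F N).ν (theta13LiveOfRecord F N).τ9 (EOfRecord₁₃ F N (theta13LiveOfRecord F N)) (wOfRecord₉ F N (theta13LiveOfRecord F N).toStage9Params) (theta13LiveOfRecord F N).ppSel P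
            (gOfRecord₁₃ F N (theta13LiveOfRecord F N) P) k s₀ ≠ 0 ∧
          chiSeqOfRecord F N (theta13LiveOfRecord F N).ν (theta13LiveOfRecord F N).τ9.M (gOfRecord₁₃ F N (theta13LiveOfRecord F N) P) P.K k s₀ (Wc k) ≠ 0 ∧
          ∀ j, j < k → PlaqSmallOn (plaqsOf (pts j (Γr P k s₀ j (s₀.Ω (j + 1))ᶜ))) (cR P * epsOfRecord (theta13LiveOfRecord F N).ν (gOfRecord₁₃ F N (theta13LiveOfRecord F N) P) j) (Wc j)})
        (UbgOfRecord₁₃CoP F N (theta13LiveOfRecord F N) P k))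
    (hbg' : ∀ P : B12.RunParams, Step.InInterval γ P.K (gOfRecord₁₃ F N (theta13LiveOfRecord F N) P) → ∀ k, k < P.K →
      BgProvisoΛ F N P.K (settingOfRecord₁₃ F N (theta13LiveOfRecord F N) P) ((theta13LiveOfRecord F N).Rz P.K) (theta13LiveOfRecord F N).τ9.M k
        (fun s : SeqOfRecord F (theta13LiveOfRecord F N).ν (theta13LiveOfRecord F N).τ9.M (gOfRecord₁₃ F N (theta13LiveOfRecord F N) P) P.K (k + 1) =>
          {Wc | slotsTOfRecord F N (theta13LiveOfRecord F N).ν (theta13LiveOfRecord F N).τ9 (EOfRecord₁₃ F N (theta13LiveOfRecord F N)) (wOfRecord₉ F N (theta13LiveOfRecord F N).toStage9Params) (theta13LiveOfRecord F N).ppSel P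
              (gOfRecord₁₃ F N (theta13LiveOfRecord F N) P) (k + 1) s ≠ 0 ∧
            chiSeqOfRecord F N (theta13LiveOfRecord F N).ν (theta13LiveOfRecord F N).τ9.M (gOfRecord₁₃ F N (theta13LiveOfRecord F N) P) P.K (k + 1) s (Wc (k + 1)) ≠ 0 ∧
            ∀ j, j < k + 1 → PlaqSmallOn (plaqsOf (pts j (Γr P (k + 1) s j (s.Ω (j + 1))ᶜ))) (cR P * epsOfRecord (theta13LiveOfRecord F N).ν (gOfRecord₁₃ F N (theta13LiveOfRecord F N) P) j) (Wc j)})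
        (UbgOfRecord₁₃CoP F N (theta13LiveOfRecord F N) P (k + 1)))
    (σ : (P : B12.RunParams) → Sect3Supplier (gaussPinH (⟨⟨theta13LiveOfRecord F N, Zr⟩, Zh, Phih⟩ : Stage13HParams F N)) P)
    (hσ : ∀ P : B12.RunParams, Step.InInterval γ P.K (gOfRecord₁₃ F N (theta13LiveOfRecord F N) P) → SupplierObligations (gaussPinH (⟨⟨theta13LiveOfRecord F N, Zr⟩, Zh, Phih⟩ : Stage13HParams F N)) P (σ P))
    (hσB : ∀ P : B12.RunParams, Step.InInterval γ P.K (gOfRecord₁₃ F N (theta13LiveOfRecord F N) P) → SupplierBorel (gaussPinH (⟨⟨theta13LiveOfRecord F N, Zr⟩, Zh, Phih⟩ : Stage13HParams F N)) P (σ P)) :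
    B16.Thm1Printed (datumOfRecord₁₃SepCoPH F N (gaussPinH (⟨⟨theta13LiveOfRecord F N, Zr⟩, Zh, Phih⟩ : Stage13HParams F N)) hG).C :=
  thm1Printed_datumOfRecord₁₃CoPH_gaussPinH_theta13LiveOfRecordH_of_supplierBorel_of_bgReadCharged F N hrec hγ cR Γr hreg hbg hbg' σ hσ hσB

end KKeyedRecord

end Summit.QuantumFields.YangMills.Theorems.BalabanUVNodesN11Sect3SupplyChainBorelBThm1Printed

end
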